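import Literature.Analysis.FluidPDE.PassiveVectorEnergyEquality
import Summits.AnomalousDissipation.AnomalousDissipation.Theorems.SolenoidalFractalHomogenisationLagrangianStepDefs
import Literature.Analysis.FluidPDE.DoeringFoiasPowerProofs
import Summits.AnomalousDissipation.AnomalousDissipation.Theorems.SolenoidalFractalHomogenisationLagrangianRenormalisationStepExistsL
import Summits.AnomalousDissipation.AnomalousDissipation.Theorems.SolenoidalFractalHomogenisationPermissibleFractalCarrierWords
import Summits.AnomalousDissipation.AnomalousDissipation.Theorems.SolenoidalFractalHomogenisationProjectedRenormalisationStepDefs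
import Summits.AnomalousDissipation.AnomalousDissipation.Theorems.SolenoidalFractalHomogenisationProjectedRenormalisationStepExists
import HarnessLib

/-!
# K1 `ProjectedRenormalisationStep` (stmt-AnomalousDissipation-19071): registered stub `stub_base` — a fixed level dissipates a
# fixed fraction of the energy by `t = 1/2`

Helper file of route `SolenoidalFractalHomogenisation` (`--supports stmt-AnomalousDissipation-19071`; registered birth skeleton sha
`e2b567d2f478eabc…`; shared vocabulary `…ProjectedRenormalisationStepDefs`; carrier facts `…ProjectedRenormalisationStepExists`).
`stub_base` (text verbatim): for every fractal shear carrier `D` and level `m` there is `c > 0` (here `c = 2π²ν/(1+4π²ν)`,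
`ν = D.kbar m`) such that every weak solution `u` of the truncated problem `P_m(D)` from an admissible datum `w₀` has
`c‖w₀‖² ≤ (kbar m)∫₀^{1/2}‖∇u‖²` (`Diss D m u`, in `[0,∞]`).  Proof: the truncated carrier is a finite sum of jointly continuous
Eulerian lattice levels, hence bounded, so every weak solution obeys the energy EQUALITY (`IsWeakPassiveVectorOn.ae_energy_eq`);
the mean is conserved (`ae_hasZeroMean`, the zero mode of `IsWeakPassiveVectorOn.ae_inner_mFourierCoeff_eq`); the spectral Poincaré inequality on mean-zero slices integrated over
`(0,1/2)` (`dissipation_half_ge_of_hasZeroMean`, the half-horizon twin of `CascadeBookkeeping.dissipation_ge_of_hasZeroMean`).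
ASIDE item; generic A0 infrastructure, NOT a proof of the crux nor of anomalous dissipation.  Rung F-D1.A0.
Prover seat `leafhand-ad-solenoidalfractalh-1` g0.
-/

set_option linter.dupNamespace false

noncomputable section

namespace Summit.AnomalousDissipation.AnomalousDissipation.Theorems.SolenoidalFractalHomogenisation.ProjectedRenormalisationStep

open Literature.Analysis Literature.Analysis.FluidPDE Literature.Analysis.FunctionSpaces
open MeasureTheory Set Filter Function
open scoped ENNReal NNReal InnerProductSpace
open Literature.Analysis.FluidPDE.Torus (eVectorDissipation vectorL2Sq)
open Literature.Analysis.FunctionSpaces.Torus (IsWeaklyDivFree stLift HasZeroMean eGradNormSq)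
open Summit.AnomalousDissipation.AnomalousDissipation.Theorems.SolenoidalFractalHomogenisation.LagrangianStep (IsDatum InClass)
open Summit.AnomalousDissipation.AnomalousDissipation.Theorems.SolenoidalFractalHomogenisation.RealisedQuasiStaticCellLaw
  (memLp_two_of_memSobolev_one_complexify)
open Summit.AnomalousDissipation.AnomalousDissipation.Theorems.SolenoidalFractalHomogenisation.LagrangianRenormalisationStep
  (continuous_uncurry_level memLp_top_stLift_of_continuous)


variable {k : ℕ}

open UnitAddTorus in
/-- **The mean of a weak passive-vector solution is conserved**: for a weak solution with integrable mean-zero datum,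
`∫ w(t) = 0` for a.e. `t ∈ (0,1)` (the `k = 0` instance of `IsWeakPassiveVectorOn.ae_inner_mFourierCoeff_eq`; route-independent
private copy of `CascadeBookkeeping.ae_hasZeroMean`, whose module imports the route file). [cite: DiPernaLions1989, §II.1 (13)–(14)] -/
private theorem ae_hasZeroMean {ν : ℝ} {b w : ℝ → UnitAddTorus (Fin 3) → EuclideanSpace ℝ (Fin 3)}
    {w₀ : UnitAddTorus (Fin 3) → EuclideanSpace ℝ (Fin 3)} (h : Torus.IsWeakPassiveVectorOn 0 1 ν b w₀ w)
    (hw₀ : Integrable w₀ volume) (h0 : HasZeroMean w₀) :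
    ∀ᵐ t ∂(volume.restrict (Ioo 0 1)), HasZeroMean (w t) := by
  have hz : ∀ i : Fin 3, ∑ j, ((0 : Fin 3 → ℤ) j : ℂ) *
      (EuclideanSpace.single i (1 : ℂ) : EuclideanSpace ℂ (Fin 3)) j = 0 := fun i => by simp
  have hall : ∀ i : Fin 3, ∀ᵐ t ∂(volume.restrict (Ioo 0 1)),
      ⟪mFourierCoeff (EuclideanSpace.complexify ∘ w t) 0, EuclideanSpace.single i (1 : ℂ)⟫_ℂ =
        ⟪mFourierCoeff (EuclideanSpace.complexify ∘ w₀) 0, EuclideanSpace.single i (1 : ℂ)⟫_ℂ := by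
    intro i
    filter_upwards [h.ae_inner_mFourierCoeff_eq hw₀ 0 (hz i)] with t ht
    rw [ht]
    simp [FunctionSpaces.Torus.freqNormSq]
  rw [← ae_all_iff] at hall
  filter_upwards [hall] with t ht
  have h0' : mFourierCoeff (EuclideanSpace.complexify ∘ w₀) 0 = 0 := by
    rw [mFourierCoeff_complexify_zero, show (∫ x, w₀ x) = 0 from h0, map_zero]
  have hv : mFourierCoeff (EuclideanSpace.complexify ∘ w t) 0 = 0 := by
    ext i
    have hi := ht i
    rw [h0', inner_zero_left, EuclideanSpace.inner_single_right] at hi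
    simpa using hi
  rw [mFourierCoeff_complexify_zero] at hv
  exact EuclideanSpace.complexify_injective (by rw [hv, map_zero])

/-- **Poincaré bookkeeping on the half horizon.** If a time-dependent field `w` on `(0,1/2)` has `L²`, mean-zero slices
and satisfies the lower energy inequality `A ≤ ‖w(t)‖² + 2ν∫₀ᵗ‖∇w‖²` for a.e. `t ∈ (0,1/2)` (in `[0,∞]`), then
`ν ∫₀^{1/2} ‖∇w‖² ≥ 2π²ν/(1+4π²ν) · A`: the spectral Poincaré inequality `4π²‖w(t)‖² ≤ ‖∇w(t)‖²` on mean-zero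
slices, integrated over `(0,1/2)` (half-horizon twin of `CascadeBookkeeping.dissipation_ge_of_hasZeroMean`). [folklore] -/
theorem dissipation_half_ge_of_hasZeroMean {ν : ℝ} (hν : 0 < ν)
    {w : ℝ → UnitAddTorus (Fin 3) → EuclideanSpace ℝ (Fin 3)} {A : ℝ}
    (hmem : ∀ᵐ t ∂(volume.restrict (Ioo 0 (1 / 2 : ℝ))), MemLp (w t) 2 volume)
    (hmean : ∀ᵐ t ∂(volume.restrict (Ioo 0 (1 / 2 : ℝ))), HasZeroMean (w t))
    (hE : ∀ᵐ t ∂(volume.restrict (Ioo 0 (1 / 2 : ℝ))),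
      ENNReal.ofReal A ≤ ENNReal.ofReal (vectorL2Sq (w t)) + 2 * eVectorDissipation ν w 0 t) :
    ENNReal.ofReal (2 * Real.pi ^ 2 * ν / (1 + 4 * Real.pi ^ 2 * ν) * A) ≤ eVectorDissipation ν w 0 (1 / 2) := by
  set E := eVectorDissipation ν w 0 (1 / 2) with hEdef
  set G : ℝ → ℝ≥0∞ := fun t => eGradNormSq (w t) with hG
  have hEG : E = ENNReal.ofReal ν * ∫⁻ t in Ioo 0 (1 / 2 : ℝ), G t := rfl
  have hmono : ∀ t ∈ Ioo (0:ℝ) (1 / 2), eVectorDissipation ν w 0 t ≤ E := fun t ht => by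
    rw [hEdef]
    unfold Torus.eVectorDissipation
    exact mul_le_mul_right (lintegral_mono_set (Ioo_subset_Ioo le_rfl ht.2.le)) _
  have hpt : ∀ᵐ t ∂(volume.restrict (Ioo 0 (1 / 2 : ℝ))),
      ENNReal.ofReal (4 * Real.pi ^ 2 * A) ≤ G t + ENNReal.ofReal (4 * Real.pi ^ 2) * (2 * E) := by
    filter_upwards [hmem, hmean, hE, ae_restrict_mem measurableSet_Ioo] with t hm h0 hEt ht
    have hP := ofReal_integral_norm_sq_le_eGradNormSq_add hm
    rw [show (∫ x, w t x) = 0 from h0, norm_zero] at hP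
    simp only [ne_eq, OfNat.ofNat_ne_zero, not_false_eq_true, zero_pow, mul_zero, ENNReal.ofReal_zero,
      add_zero] at hP
    change ENNReal.ofReal (4 * Real.pi ^ 2 * vectorL2Sq (w t)) ≤ G t at hP
    have e1 : ENNReal.ofReal (4 * Real.pi ^ 2 * vectorL2Sq (w t)) =
        ENNReal.ofReal (4 * Real.pi ^ 2) * ENNReal.ofReal (vectorL2Sq (w t)) := ENNReal.ofReal_mul (by positivity)
    rw [e1] at hP
    have hEt' : ENNReal.ofReal A ≤ ENNReal.ofReal (vectorL2Sq (w t)) + 2 * E :=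
      hEt.trans (add_le_add le_rfl (mul_le_mul_right (hmono t ht) 2))
    calc ENNReal.ofReal (4 * Real.pi ^ 2 * A)
        = ENNReal.ofReal (4 * Real.pi ^ 2) * ENNReal.ofReal A := ENNReal.ofReal_mul (by positivity)
      _ ≤ ENNReal.ofReal (4 * Real.pi ^ 2) * (ENNReal.ofReal (vectorL2Sq (w t)) + 2 * E) := by gcongr
      _ = ENNReal.ofReal (4 * Real.pi ^ 2) * ENNReal.ofReal (vectorL2Sq (w t)) +
            ENNReal.ofReal (4 * Real.pi ^ 2) * (2 * E) := mul_add _ _ _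
      _ ≤ G t + ENNReal.ofReal (4 * Real.pi ^ 2) * (2 * E) := add_le_add hP le_rfl
  -- integrate over `(0, 1/2)`
  have hhalf : (volume.restrict (Ioo 0 (1 / 2 : ℝ))) univ = ENNReal.ofReal (1 / 2) := by
    rw [Measure.restrict_apply_univ, Real.volume_Ioo, sub_zero]
  have hint : ENNReal.ofReal (4 * Real.pi ^ 2 * A) * ENNReal.ofReal (1 / 2) ≤
      (∫⁻ t in Ioo 0 (1 / 2 : ℝ), G t) + ENNReal.ofReal (4 * Real.pi ^ 2) * (2 * E) * ENNReal.ofReal (1 / 2) := by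
    have h := lintegral_mono_ae hpt
    rw [lintegral_const, hhalf, lintegral_add_right _ measurable_const, lintegral_const, hhalf] at h
    exact h
  -- multiply by `ν`
  have hkey : ENNReal.ofReal (2 * Real.pi ^ 2 * ν * A) ≤ (1 + ENNReal.ofReal (4 * Real.pi ^ 2 * ν)) * E := by
    have h := mul_le_mul_right hint (ENNReal.ofReal ν)
    calc ENNReal.ofReal (2 * Real.pi ^ 2 * ν * A)
        = ENNReal.ofReal ν * (ENNReal.ofReal (4 * Real.pi ^ 2 * A) * ENNReal.ofReal (1 / 2)) := by
          rw [mul_comm (ENNReal.ofReal (4 * Real.pi ^ 2 * A)), ← ENNReal.ofReal_mul (by norm_num : (0:ℝ) ≤ 1 / 2),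
            ← ENNReal.ofReal_mul hν.le]
          ring_nf
      _ ≤ ENNReal.ofReal ν * ((∫⁻ t in Ioo 0 (1 / 2 : ℝ), G t) + ENNReal.ofReal (4 * Real.pi ^ 2) * (2 * E) * ENNReal.ofReal (1 / 2)) := h
      _ = E + ENNReal.ofReal ν * (ENNReal.ofReal (4 * Real.pi ^ 2) * (2 * E) * ENNReal.ofReal (1 / 2)) := by
          rw [mul_add, ← hEG]
      _ = E + ENNReal.ofReal (4 * Real.pi ^ 2 * ν) * E := by
          congr 1
          rw [← ENNReal.ofReal_ofNat 2]
          have e2 : ENNReal.ofReal ν * (ENNReal.ofReal (4 * Real.pi ^ 2) * (ENNReal.ofReal 2 * E) * ENNReal.ofReal (1 / 2))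
              = (ENNReal.ofReal ν * ENNReal.ofReal (4 * Real.pi ^ 2) * ENNReal.ofReal 2 * ENNReal.ofReal (1 / 2)) * E := by ring
          rw [e2, ← ENNReal.ofReal_mul hν.le, ← ENNReal.ofReal_mul (by positivity), ← ENNReal.ofReal_mul (by positivity)]
          congr 1
          ring_nf
      _ = (1 + ENNReal.ofReal (4 * Real.pi ^ 2 * ν)) * E := by ring
  -- conclude
  by_cases hEtop : E = ∞
  · rw [hEtop]; exact le_top
  have h1top : (1 + ENNReal.ofReal (4 * Real.pi ^ 2 * ν)) * E ≠ ∞ :=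
    ENNReal.mul_ne_top (by simp) hEtop
  have hreal : 2 * Real.pi ^ 2 * ν * A ≤ (1 + 4 * Real.pi ^ 2 * ν) * E.toReal := by
    have h := (ENNReal.ofReal_le_iff_le_toReal h1top).1 hkey
    rwa [ENNReal.toReal_mul, ENNReal.toReal_add (by simp) ENNReal.ofReal_ne_top, ENNReal.toReal_one,
      ENNReal.toReal_ofReal (by positivity)] at h
  refine (ENNReal.ofReal_le_iff_le_toReal hEtop).2 ?_
  rw [div_mul_eq_mul_div, div_le_iff₀ (by positivity)]
  linarith

/-- **Registered stub `stub_base` (K1 skeleton e2b567d2, text verbatim): at any fixed level `m` the truncated problem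
dissipates a fixed fraction of the energy by `t = 1/2`.**  With `ν = D.kbar m > 0` and `c = 2π²ν/(1+4π²ν)`: the truncated
carrier `carrierUpTo D m` is a finite sum of jointly continuous Eulerian lattice levels, hence bounded on `(0,1) × 𝕋³`, so
every weak solution obeys the energy EQUALITY (`IsWeakPassiveVectorOn.ae_energy_eq`); the mean is conserved
(`ae_hasZeroMean`, the zero mode of `IsWeakPassiveVectorOn.ae_inner_mFourierCoeff_eq`), and the spectral Poincaré inequality on mean-zero slices integrated over `(0,1/2)`
gives `ν∫₀^{1/2}‖∇u‖² ≥ c‖w₀‖²`. [cite: ArmstrongVicol2025, §5.4 (PDF p. 65, first display: the base level)] -/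
theorem stub_base : ∀ k (D : LatticeShear.FractalCarrierData k) (m : ℕ), ∃ c : ℝ, 0 < c ∧
    ∀ (w₀ : UnitAddTorus (Fin 3) → EuclideanSpace ℝ (Fin 3)) (u : ℝ → UnitAddTorus (Fin 3) → EuclideanSpace ℝ (Fin 3)),
      IsDatum w₀ → TruncSol D m w₀ u → ENNReal.ofReal (c * Torus.vectorL2Sq w₀) ≤ Diss D m u := by
  intro k D m
  have hν := D.kbar_pos m
  refine ⟨2 * Real.pi ^ 2 * D.kbar m / (1 + 4 * Real.pi ^ 2 * D.kbar m), by positivity, fun w₀ u hw₀ hu => ?_⟩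
  have hb := memLp_top_stLift_of_continuous (continuous_uncurry_carrierUpTo D m) 1
  have hw₀2 : MemLp w₀ 2 volume := memLp_two_of_memSobolev_one_complexify hw₀.1
  have hu' : Torus.IsWeakPassiveVectorOn 0 1 (D.kbar m) (carrierUpTo D m) w₀ u := hu
  have hE := hu'.ae_energy_eq hν hw₀2 hw₀.2.2 hb
  have hsub : Ioo (0:ℝ) (1 / 2) ⊆ Ioo 0 1 := Ioo_subset_Ioo le_rfl (by norm_num)
  have hE' : ∀ᵐ t ∂(volume.restrict (Ioo 0 (1 / 2 : ℝ))),
      ENNReal.ofReal (vectorL2Sq w₀) ≤ ENNReal.ofReal (vectorL2Sq (u t)) + 2 * eVectorDissipation (D.kbar m) u 0 t := by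
    filter_upwards [ae_restrict_of_ae_restrict_of_subset hsub hE] with t ht
    exact le_of_eq ht.symm
  have hmem := ae_restrict_of_ae_restrict_of_subset hsub hu'.ae_memLp_two
  have hmean := ae_restrict_of_ae_restrict_of_subset hsub (ae_hasZeroMean hu' (hw₀2.integrable one_le_two) hw₀.2.1)
  exact dissipation_half_ge_of_hasZeroMean hν hmem hmean hE'

end Summit.AnomalousDissipation.AnomalousDissipation.Theorems.SolenoidalFractalHomogenisation.ProjectedRenormalisationStep

end
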